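import Literature.MathematicalPhysics.StatisticalMechanics.BarlowStacking
import Literature.MathematicalPhysics.StatisticalMechanics.BarlowStackingWindowRebase
import Summits.AtomisticToContinuum.Crystallization.Theorems.MinMeanCycleStackingLockBarlowEnergyIdentification

/-!
# Crux `PricedLinkCensus.TruncatedCensusGap` (stmt-AtomisticToContinuum-14230), line `near-far-split`,
# stub N2 `stub_harmonicCoercivityWindow`: the two double `tsum`s are finite sums

The harmonic-coercivity inequality of N2 compares two double sums
`∑' p : barlowStacking a h s, ∑' q : barlowStacking a h s, F p q` whose summands vanish unless
`u p ≠ 0 ∨ u q ≠ 0` (a finite set `U` of sites) and `dist p q ≤ R` (`R = 11a/10` for the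
nearest-neighbour form, `R = 2` for the `V_χ` Hessian form).  Since a Barlow stacking with
`0 < a`, `0 < h` is uniformly discrete, the sites within `R` of `U` form a FINITE set `T`
(`finite_barlowStacking_near`), and both `tsum`s are honest finite sums over `T`
(`tsum_tsum_subtype_eq_sum_sum_of_vanish`, `tsum_tsum_barlowStacking_eq_sum_sum`); in particular no
summability issue hides in the statement of N2 (`harmonicForms_eq_sum_sum`).  We also record the
reindexing of such double sums by `ℤ³ × ℤ³` through the bijection `barlowPos`
(`tsum_tsum_barlowStacking_eq_tsum_int`), the form in which a Bloch/Fourier analysis starts.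
All `[folklore]`.
-/

noncomputable section

namespace Summit.AtomisticToContinuum.Crystallization.Theorems.PricedLinkCensusTruncatedCensusGap

open scoped BigOperators
open Literature.MathematicalPhysics.StatisticalMechanics
open Summit.AtomisticToContinuum.Crystallization.Theorems (barlowPos_injective)

/-! ## Sums over a subtype supported on a finite set -/

section Finite

variable {β α : Type*} [AddCommMonoid α] [TopologicalSpace α]

/-- A `tsum` over a subtype `S` whose summand vanishes on `S` off a finite set `T ⊆ S` is the
finite sum over `T`. [folklore] -/
theorem tsum_subtype_eq_sum_of_vanish {S : Set β} (T : Finset β) (hTS : ↑T ⊆ S) (G : β → α)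
    (hG : ∀ p ∈ S, p ∉ T → G p = 0) : ∑' p : S, G p = ∑ p ∈ T, G p := by
  classical
  rw [tsum_subtype S G, tsum_eq_sum (s := T)]
  · refine Finset.sum_congr rfl fun p hp => ?_
    rw [Set.indicator_of_mem (hTS hp)]
  · intro p hp
    by_cases hpS : p ∈ S
    · rw [Set.indicator_of_mem hpS, hG p hpS hp]
    · rw [Set.indicator_of_notMem hpS]

/-- **A double `tsum` over a subtype `S` is a double finite sum** over `T ⊆ S` when the summand
`F p q` (`p, q ∈ S`) vanishes as soon as `p ∉ T` or `q ∉ T`. [folklore] -/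
theorem tsum_tsum_subtype_eq_sum_sum_of_vanish {S : Set β} (T : Finset β) (hTS : ↑T ⊆ S)
    (F : β → β → α) (hF : ∀ p ∈ S, ∀ q ∈ S, (p ∉ T ∨ q ∉ T) → F p q = 0) :
    ∑' p : S, ∑' q : S, F p q = ∑ p ∈ T, ∑ q ∈ T, F p q := by
  have inner : ∀ p ∈ S, ∑' q : S, F p q = ∑ q ∈ T, F p q := fun p hp =>
    tsum_subtype_eq_sum_of_vanish T hTS (F p) fun q hq hqT => hF p hp q hq (Or.inr hqT)
  rw [tsum_subtype_eq_sum_of_vanish T hTS (fun p => ∑' q : S, F p q)]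
  · exact Finset.sum_congr rfl fun p hp => inner p (hTS hp)
  · intro p hp hpT
    rw [inner p hp]
    exact Finset.sum_eq_zero fun q hq => hF p hp q (hTS hq) (Or.inl hpT)

end Finite

/-! ## Finiteness of neighbourhoods of finite sets in a Barlow stacking -/

section Stacking

variable {a h : ℝ} (s : ℤ → ℤ)

/-- **The sites of a Barlow stacking within `R` of a finite set form a finite set** (`0 < a`,
`0 < h`: the stacking is `min a h`-separated). [folklore] -/
theorem finite_barlowStacking_near (ha : 0 < a) (hh : 0 < h) {U : Set (EuclideanSpace ℝ (Fin 3))}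
    (hU : U.Finite) (R : ℝ) :
    {x ∈ barlowStacking a h s | ∃ y ∈ U, dist x y ≤ R}.Finite := by
  have h1 : {x ∈ barlowStacking a h s | ∃ y ∈ U, dist x y ≤ R} =
      ⋃ y ∈ U, {x ∈ barlowStacking a h s | dist x y ≤ R} := by
    ext x
    simp only [Set.mem_setOf_eq, Set.mem_iUnion, exists_prop]
    constructor
    · rintro ⟨hx, y, hy, hxy⟩
      exact ⟨y, hy, hx, hxy⟩
    · rintro ⟨y, hy, hx, hxy⟩
      exact ⟨hx, y, hy, hxy⟩
  rw [h1]
  refine hU.biUnion fun y _ => ?_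
  obtain ⟨N', P, -, hP⟩ := exists_fin_enum_barlowStacking_dist_le a h s y R ha hh
  rw [← hP]
  exact Set.finite_range P

/-- **Double sums over a Barlow stacking with a local, finitely sourced summand are finite double
sums.**  If `F p q` vanishes unless `p ∈ U ∨ q ∈ U` and vanishes for `dist p q > R` (`0 ≤ R`),
then for every finite `T` with `{x ∈ S | ∃ y ∈ U, dist x y ≤ R} ⊆ T ⊆ S`
(`S = barlowStacking a h s`; such `T` exist by `finite_barlowStacking_near`) the double `tsum` over
`S` is the double sum over `T`. [folklore] -/
theorem tsum_tsum_barlowStacking_eq_sum_sum {U : Set (EuclideanSpace ℝ (Fin 3))} {R : ℝ}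
    (hR : 0 ≤ R) (F : EuclideanSpace ℝ (Fin 3) → EuclideanSpace ℝ (Fin 3) → ℝ)
    (hFU : ∀ p q, p ∉ U → q ∉ U → F p q = 0) (hFR : ∀ p q, R < dist p q → F p q = 0)
    (T : Finset (EuclideanSpace ℝ (Fin 3))) (hTS : ↑T ⊆ barlowStacking a h s)
    (hUT : {x ∈ barlowStacking a h s | ∃ y ∈ U, dist x y ≤ R} ⊆ ↑T) :
    ∑' p : barlowStacking a h s, ∑' q : barlowStacking a h s, F p q =
      ∑ p ∈ T, ∑ q ∈ T, F p q := by
  refine tsum_tsum_subtype_eq_sum_sum_of_vanish T hTS F fun p hp q hq hpq => ?_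
  -- a site of `U ∩ S` is in `T`, and so is every site within `R` of it
  have memT : ∀ x ∈ barlowStacking a h s, ∀ y ∈ U, dist x y ≤ R → x ∈ (T : Set _) :=
    fun x hx y hy hxy => hUT ⟨hx, y, hy, hxy⟩
  by_cases hfar : R < dist p q
  · exact hFR p q hfar
  have hnear : dist p q ≤ R := not_lt.1 hfar
  by_cases hpU : p ∈ U
  · have hpT : p ∈ (T : Set _) := memT p hp p hpU (by rw [dist_self]; exact hR)
    have hqT : q ∈ (T : Set _) := memT q hq p hpU (by rwa [dist_comm])
    exact absurd hpq (not_or.2 ⟨not_not.2 hpT, not_not.2 hqT⟩)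
  by_cases hqU : q ∈ U
  · have hqT : q ∈ (T : Set _) := memT q hq q hqU (by rw [dist_self]; exact hR)
    have hpT : p ∈ (T : Set _) := memT p hp q hqU hnear
    exact absurd hpq (not_or.2 ⟨not_not.2 hpT, not_not.2 hqT⟩)
  exact hFU p q hpU hqU

/-! ## Reindexing by `ℤ³` -/

/-- The stacking is the range of the parametrisation `barlowPos`. [folklore] -/
theorem barlowStacking_eq_range (a h : ℝ) :
    barlowStacking a h s = Set.range fun q : ℤ × ℤ × ℤ => barlowPos a h s q.1 q.2.1 q.2.2 := by
  ext x
  simp only [mem_barlowStacking_iff, Set.mem_range, Prod.exists]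
  constructor
  · rintro ⟨k, i, j, rfl⟩
    exact ⟨k, i, j, rfl⟩
  · rintro ⟨k, i, j, rfl⟩
    exact ⟨k, i, j, rfl⟩

/-- **Double sums over a Barlow stacking reindexed by `ℤ³ × ℤ³`** through the bijection
`(k, i, j) ↦ barlowPos a h s k i j` (`0 < a`, `0 < h`). [folklore] -/
theorem tsum_tsum_barlowStacking_eq_tsum_int (ha : 0 < a) (hh : 0 < h)
    (F : EuclideanSpace ℝ (Fin 3) → EuclideanSpace ℝ (Fin 3) → ℝ) :
    ∑' p : barlowStacking a h s, ∑' q : barlowStacking a h s, F p q =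
      ∑' x : ℤ × ℤ × ℤ, ∑' y : ℤ × ℤ × ℤ,
        F (barlowPos a h s x.1 x.2.1 x.2.2) (barlowPos a h s y.1 y.2.1 y.2.2) := by
  set g : ℤ × ℤ × ℤ → EuclideanSpace ℝ (Fin 3) := fun q => barlowPos a h s q.1 q.2.1 q.2.2
    with hg
  have hginj : Function.Injective g := barlowPos_injective ha hh s
  have hS : barlowStacking a h s = Set.range g := barlowStacking_eq_range s a h
  rw [hS]
  set e := Equiv.ofInjective g hginj with he
  have inner : ∀ p : EuclideanSpace ℝ (Fin 3),
      ∑' q : Set.range g, F p q = ∑' y : ℤ × ℤ × ℤ, F p (g y) := by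
    intro p
    rw [← Equiv.tsum_eq e]
    rfl
  simp_rw [inner]
  rw [← Equiv.tsum_eq e]
  rfl

end Stacking

/-! ## The two forms of N2 -/

/-- **The two forms of N2 are finite sums.**  For a pair kernel `hessV` of range `2`
(`hessV e w = 0` for `‖e‖ > 2`) vanishing at `w = 0`, a spacing `a ≤ 51/50` and any field `u`,
both the nearest-neighbour form and the Hessian form of `stub_harmonicCoercivityWindow` over
`S = barlowStacking a h s` are the finite double sums over any finite `T` with
`{x ∈ S | ∃ y ∈ support u, dist x y ≤ 2} ⊆ T ⊆ S` (for `0 < a`, `0 < h` and finitely supported `u`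
such `T` exist by `finite_barlowStacking_near`). [folklore] -/
theorem harmonicForms_eq_sum_sum :
    ∀ (a h : ℝ) (s : ℤ → ℤ) (hessV : EuclideanSpace ℝ (Fin 3) → EuclideanSpace ℝ (Fin 3) → ℝ), (∀ e : EuclideanSpace ℝ (Fin 3), hessV e 0 = 0) → (∀ e w : EuclideanSpace ℝ (Fin 3), 2 < ‖e‖ → hessV e w = 0) → a ≤ 51 / 50 → ∀ (u : EuclideanSpace ℝ (Fin 3) → EuclideanSpace ℝ (Fin 3)) (T : Finset (EuclideanSpace ℝ (Fin 3))), (T : Set (EuclideanSpace ℝ (Fin 3))) ⊆ Literature.MathematicalPhysics.StatisticalMechanics.barlowStacking a h s → {x : EuclideanSpace ℝ (Fin 3) | x ∈ Literature.MathematicalPhysics.StatisticalMechanics.barlowStacking a h s ∧ ∃ y ∈ Function.support u, dist x y ≤ 2} ⊆ (T : Set (EuclideanSpace ℝ (Fin 3))) → (∑' p : Literature.MathematicalPhysics.StatisticalMechanics.barlowStacking a h s, ∑' q : Literature.MathematicalPhysics.StatisticalMechanics.barlowStacking a h s, if dist (p : EuclideanSpace ℝ (Fin 3)) q ≤ 11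 / 10 * a then ‖u p - u q‖ ^ 2 else 0) = ∑ p ∈ T, ∑ q ∈ T, (if dist p q ≤ 11 / 10 * a then ‖u p - u q‖ ^ 2 else 0) ∧ (∑' p : Literature.MathematicalPhysics.StatisticalMechanics.barlowStacking a h s, ∑' q : Literature.MathematicalPhysics.StatisticalMechanics.barlowStacking a h s, if (p : EuclideanSpace ℝ (Fin 3)) ≠ q then hessV ((p : EuclideanSpace ℝ (Fin 3)) - q) (u p - u q) else 0) = ∑ p ∈ T, ∑ q ∈ T, (if p ≠ q then hessV (p - q) (u p - u q) else 0) := by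
  intro a h s hessV h0 hfar ha2 u T hTS hUT
  have hUT' : {x ∈ barlowStacking a h s | ∃ y ∈ Function.support u, dist x y ≤ 2} ⊆ ↑T := hUT
  constructor
  · refine tsum_tsum_barlowStacking_eq_sum_sum s zero_le_two
      (fun p q => if dist p q ≤ 11 / 10 * a then ‖u p - u q‖ ^ 2 else 0) ?_ ?_ T hTS hUT'
    · intro p q hp hq
      rw [Function.notMem_support] at hp hq
      simp [hp, hq]
    · intro p q hpq
      have : ¬ dist p q ≤ 11 / 10 * a := not_le.2 (by linarith)
      simp [this]
  · refine tsum_tsum_barlowStacking_eq_sum_sum s zero_le_two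
      (fun p q => if p ≠ q then hessV (p - q) (u p - u q) else 0) ?_ ?_ T hTS hUT'
    · intro p q hp hq
      rw [Function.notMem_support] at hp hq
      simp [hp, hq, h0]
    · intro p q hpq
      have h2 : 2 < ‖p - q‖ := by rwa [← dist_eq_norm]
      simp [hfar _ _ h2]

end Summit.AtomisticToContinuum.Crystallization.Theorems.PricedLinkCensusTruncatedCensusGap

end
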